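import Summits.QuantumFields.YangMills.Theorems.UnitScaleTiltProp7CornerFrameLegsFlatRow
import Summits.QuantumFields.YangMills.Theorems.UnitScaleTiltProp7QTwFlatExplicitT3
import Summits.QuantumFields.YangMills.Theorems.UnitScaleTiltProp7FlatHessKOnSlice
import Summits.QuantumFields.YangMills.Theorems.UnitScaleTiltProp7CovariantWeitzenbock
import Summits.QuantumFields.YangMills.Theorems.UnitScaleTiltProp7RieszTauFrobNormT3
import HarnessLib

/-!
# Route `UnitScaleTilt`, crux K1 «MinimiserStabilityRegPr» (stmt-QuantumFields-19200), stub `stub_existenceMinimalOrbit` (EX), LANE II (B4★)∕(QB) —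
# ★★★ THE ROW (QB) «TRUE AVERAGE ≤ TWISTED AVERAGE + LEGS» AT THE FLAT MEMBER, IN EVERY DIRECTION, UNCONDITIONAL:
# `Σ_ĉ ‖Q₁^{(K−n)}A ĉ‖² ≤ 2·Σ_c ‖QTw 1 A c‖²_F + Cq(L)·ℓ·(CURL_HS(1, A) + DIV_HS(1, A))`, `Cq(L) = 2·Cr(L)` L-ONLY (no `K`, no volume, no log)

Cell `ym3-torus` (HUMAN RULING D-0037, YM ladder rung R3 — YM₃ on T³ is a rung, NOT d = 4, NOT infinite volume, NOT a mass gap, NOT Clay; the YM gap is NOT proved),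
width seat `ym3-torus-px19` (gen 7; lineage pen (QB)∕(R-LEGS), ★p1 g19 NAMER WORDS №5–№11).  THEOREMS ONLY (0 `def`, 0 `sorry`); `--supports stmt-QuantumFields-19200
--as helper`, count-neutral; nothing here claims the stub, the crux or any summit statement.

THE ROW.  (QB) is the displayed hypothesis `hQB` of ✓`Prop7EngOfTrueAvgBudget.hEng_of_trueAvgBudget` (px19 g6): for every `M₂(ℂ)`-valued one-form `A` on the finest torus
`T^{(K)}` of the member, the honest `(K−n)`-fold linearised average `Q^{(K−n)}A` (print's `Q_k(U)A`, [Balaban1985BackgroundPropagators] (3.13)–(3.15)) is bounded in `ℓ²` by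
the comb-chart average `QTw W A` (✓`Prop7SymAvgTw.QTw`, [Balaban1985Averaging] (89)∕(125)–(127)∕(160)) plus `ℓ·(‖curl_W A‖² + ‖div_W A‖²)` plus an `e·ℓ⁻¹` mass slot.
THIS FILE proves the row AT THE FLAT MEMBER `W = 1` with NO mass slot, for EVERY direction `A`, from four landed theorems:
(1) at `W = 1` the true linearised (0.4)-step IS the tree's `linAvg` (✓`Prop7FlatHessKOnSlice.trueLinStep_one_eq_linAvg`), so `Q₁` is a `(J5)`-family;
(2) px21's explicit formula ✓`Prop7QTwFlatExplicit.QTw_one_apply`: `QTw 1 A c = Q₁^{(K−n)}A ĉ − (r₁A(ŷ(c₋)) − r₁A(ŷ(c₊)))`, hence `‖Q₁^{(K−n)}A ĉ‖² ≤ 2‖QTw 1 A c‖² + 2‖legs‖²`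
    and `‖·‖ ≤ ‖·‖_F` (✓`Prop7RieszTauFrobNorm.norm_le_norm_frobEquiv_symm`);
(3) the flat corner-frame legs row ✓`Prop7CornerFrameLegsFlatRow.rlegs_flat` (px19 g6, UNCONDITIONAL): `Σ_c‖legs‖² ≤ Cr(L)·ℓ·Σ_{x κ ν}‖A(x+e_ν, κ) − A(x, κ)‖²`;
(4) the flat lattice Weitzenböck inequality BY NAME — ★p1's ✓`Prop7CovariantCoercivity.sum_covD_sq_le_curl_sq_add_divB_sq` at the unitary background `1` with plaquette
    deviation `a = 0` ([Balaban1984PropagatorsI] (1.21)): `Σ_{x κ ν}‖A(x+e_ν, κ) − A(x, κ)‖² ≤ Σ‖·‖²_HS ≤ CURL_HS(1, A) + DIV_HS(1, A)` in (QB)'s own `curl (torusT …)`∕`divB` letters.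
Hence `Cq(L) := 2·Cr(L)`.  §3 restates the row in `hQB`'s exact shape (the `e`-slot re-enters as a non-negative add-on) and specialises it to CENTRAL fields `A = c·1` — the
hypothesis `hflat` of px10's `Prop7TrueAvgBudgetCentral.trueAvgBudget_smul_one_of_flat` TOKEN FOR TOKEN, so that with ✓`Prop7TrueLinCentralRegPr` (px10 (7)) the central sector of
(QB) at `W ∈ RegPr` closes by name.

WHAT IS PROVED (ns `…Theorems.Prop7TrueAvgBudgetFlat`):
* §1 flat dictionary: `covD_torusT_one_apply` (`D_{1,ν}Y_μ(x) = Y(x+e_ν, μ) − Y(x, μ)`), `norm_plaqU_torusT_one_sub_one` (the flat plaquette variables are `1`),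
  ★`sum_gradHS_le_curlHS_add_divBHS_one` (flat Weitzenböck, HS form), ★`sum_grad_sq_le_curlHS_add_divBHS_one` (operator-norm gradient energy ≤ CURL_HS + DIV_HS) — the flat
  reading, in (QB)'s `x κ ν` letters, of ★routeR-w2's curved op-norm form ✓`Prop7CovIterLambdaHLambdaBridge.sum_normSq_covGrad_le_curl_divB` (there: `SU(N)` background with
  `dist1(U₀(∂p)) ≤ a`, bond-indexed, `+ 2daN·Σ‖Y‖²`); stated here at `U₀ = 1` without the curvature slot so that §2 needs no plaquette hypothesis.
* §2 ★★★`trueAvgBudget_flat` — the row above (`∀ L > 1, ∃ Cq ≥ 0, ∀ F (F.L = L) n K (n < K) Q₁ (hQ0₁) (hQs₁ = hQB's recursion text at W := 1) A, …`).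
* §3 ★★`trueAvgBudget_flat_row` (hQB's right side at `W := 1` with any `Cq′ e`, `0 ≤ Cq′·e`), ★★`trueAvgBudget_smul_one_flat` (central fields; = px10 (8)'s `hflat`).
HONEST SCOPE.  Flat background only; a by-name knit of four landed rows; nothing of (QB) at a curved `W` (the curved (R-LEGS) row is w4-20520's pen), (ENG), (REC), `hN06`, EX or
the crux is proved here; nothing continuum ∕ OS ∕ mass-gap ∕ Clay.

References: T. Bałaban, CMP **99** (1985) 389–434 [Balaban1985BackgroundPropagators] ((3.3)–(3.4) pp.390–391, (3.8)–(3.10) p.392, (3.13)–(3.15) p.393); CMP **98** (1985)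
17–51 [Balaban1985Averaging] ((89) p.31, (124)–(127) pp.36–37, (160) p.42, (18)–(20) p.21); CMP **95** (1984) 17–40 [Balaban1984PropagatorsI] ((1.18)–(1.21) pp.19–21);
CMP **102** (1985) 277–309 [Balaban1985Variational] ((14) p.280, (44) p.285, (135) p.298).
-/

set_option autoImplicit false

noncomputable section

open scoped BigOperators Matrix.Norms.L2Operator Matrix

namespace Summit.QuantumFields.YangMills.Theorems.Prop7TrueAvgBudgetFlat

open Literature.MathematicalPhysics.QuantumFieldTheory.Balaban1983to89
open Literature.MathematicalPhysics.QuantumFieldTheory.Balaban1983to89.T3ContinuumYM3Torus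
open Finset T4Continuum BlockAveraging AveragingRT ExpMeanLog BlockAveragingEMLLinearised BlockAveragingEMLLinearisedBackground
open B9Eq39Adjoint (R R_one covD covDstar curl divB plaqU)
open B10Eq27TorusAxialLog (unitsField toUField transl)
open B9TorusCalculus (torusT torusT_apply)
open T3LevelShift (bondShift)
open T3PrintedRegularOrbits (sites_eq)
open B7Prop3Flat (Fhat)
open B7Prop4Flat (linQIter)
open Literature.MathematicalPhysics.QuantumFieldTheory.Balaban1983to89.B4Eq19LatticeOperators (Zd)
open Summit.QuantumFields.YangMills.Theorems.Prop7SPrint (basePt)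
open Summit.QuantumFields.YangMills.Theorems.Prop7SectET3HilbertLetters (W₂ frobEquiv)
open Summit.QuantumFields.YangMills.Theorems.Prop7SymAvgTw (coordT3 QTw)
open Summit.QuantumFields.YangMills.Theorems.Prop7QTwFlatExplicit (QTw_one_apply)
open Summit.QuantumFields.YangMills.Theorems.Prop7FlatHessKOnSlice (unitsField_toUField_one trueLinStep_one_eq_linAvg)
open Summit.QuantumFields.YangMills.Theorems.Prop7CovariantCoercivity (sum_covD_sq_le_curl_sq_add_divB_sq)
open Summit.QuantumFields.YangMills.Theorems.Prop7RieszTauFrobNorm (norm_le_norm_frobEquiv_symm)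
open Summit.QuantumFields.YangMills.Theorems.Prop7CornerFrameLegsFlatRow (rlegs_flat)

/-! ## §1 The flat dictionary and the flat lattice Weitzenböck inequality in (QB)'s letters -/

section Flat

variable {P : Params}

/-- At the flat background the covariant derivative (3.3) is the forward difference: `D_{1,ν}Y_μ(x) = Y(x+e_ν, μ) − Y(x, μ)`.
[cite: Balaban1985BackgroundPropagators, (3.3) p.390] -/
theorem covD_torusT_one_apply (Y : PBond P 0 → Matrix (Fin 2) (Fin 2) ℂ) (μ ν : Fin P.d) (x : Site P 0) :
    covD (torusT P 0) (fun κ z => unitsField (toUField (1 : GaugeField P 0 (Matrix.specialUnitaryGroup (Fin 2) ℂ))) ⟨z, κ⟩) ν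
        (fun z => Y ⟨z, μ⟩) x = Y ⟨x.shift ν, μ⟩ - Y ⟨x, μ⟩ := by
  simp only [B9Eq39Adjoint.covD, unitsField_toUField_one, R_one, torusT_apply]

/-- At the flat background every plaquette variable (3.23) is `1`: `‖U(∂p) − 1‖ ≤ 0`. [cite: Balaban1985BackgroundPropagators, (3.23) p.394] -/
theorem norm_plaqU_torusT_one_sub_one (μ ν : Fin P.d) (x : Site P 0) :
    ‖((plaqU (torusT P 0) (fun κ z => unitsField (toUField (1 : GaugeField P 0 (Matrix.specialUnitaryGroup (Fin 2) ℂ))) ⟨z, κ⟩) μ ν x :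
        (Matrix (Fin 2) (Fin 2) ℂ)ˣ) : Matrix (Fin 2) (Fin 2) ℂ) - 1‖ ≤ 0 := by
  simp only [B9Eq39Adjoint.plaqU, unitsField_toUField_one, mul_one, inv_one, Units.val_one, sub_self, norm_zero, le_refl]

/-- ★ **THE FLAT LATTICE WEITZENBÖCK INEQUALITY, HS FORM, IN (QB)'s LETTERS** ([Balaban1984PropagatorsI] (1.21) at `U = 1`, read off ★p1's curved quadratic-form
inequality ✓`Prop7CovariantCoercivity.sum_covD_sq_le_curl_sq_add_divB_sq` with plaquette deviation `a = 0`): for every `M₂(ℂ)`-valued one-form `Y` on the torus,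
`Σ_x Σ_μ Σ_ν Σ_{jk} |(Y(x+e_ν, μ) − Y(x, μ))_{jk}|² ≤ CURL_HS(1, Y) + DIV_HS(1, Y)`. [cite: Balaban1984PropagatorsI, (1.21) p.21; Balaban1985Variational, (135) p.298] -/
theorem sum_gradHS_le_curlHS_add_divBHS_one (Y : PBond P 0 → Matrix (Fin 2) (Fin 2) ℂ) :
    ∑ x : Site P 0, ∑ μ : Fin P.d, ∑ ν : Fin P.d, ∑ j : Fin 2, ∑ k : Fin 2, ‖(Y ⟨x.shift ν, μ⟩ - Y ⟨x, μ⟩) j k‖ ^ 2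
      ≤ (∑ x : Site P 0, ∑ μ : Fin P.d, ∑ ν : Fin P.d,
            (if μ < ν then ∑ j : Fin 2, ∑ k : Fin 2,
              ‖(curl (torusT P 0) (fun κ z => unitsField (toUField (1 : GaugeField P 0 (Matrix.specialUnitaryGroup (Fin 2) ℂ))) ⟨z, κ⟩)
                  (fun κ z => Y ⟨z, κ⟩) μ ν x) j k‖ ^ 2 else 0))
        + (∑ x : Site P 0, ∑ j : Fin 2, ∑ k : Fin 2,
            ‖(divB (torusT P 0) (fun κ z => unitsField (toUField (1 : GaugeField P 0 (Matrix.specialUnitaryGroup (Fin 2) ℂ))) ⟨z, κ⟩)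
                (fun κ z => Y ⟨z, κ⟩) x) j k‖ ^ 2) := by
  have hU : ∀ (ν : Fin P.d) (x : Site P 0),
      ((unitsField (toUField (1 : GaugeField P 0 (Matrix.specialUnitaryGroup (Fin 2) ℂ))) ⟨x, ν⟩ : (Matrix (Fin 2) (Fin 2) ℂ)ˣ) :
        Matrix (Fin 2) (Fin 2) ℂ) ∈ unitary (Matrix (Fin 2) (Fin 2) ℂ) := by
    intro ν x
    rw [unitsField_toUField_one, Units.val_one]
    exact Submonoid.one_mem _
  have h := sum_covD_sq_le_curl_sq_add_divB_sq (P := P) (i := 0) (N := 2)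
    (U := fun κ z => unitsField (toUField (1 : GaugeField P 0 (Matrix.specialUnitaryGroup (Fin 2) ℂ))) ⟨z, κ⟩)
    hU (a := 0) (fun μ ν x => norm_plaqU_torusT_one_sub_one μ ν x) (fun κ z => Y ⟨z, κ⟩)
  simp only [covD_torusT_one_apply, mul_zero, zero_mul, add_zero] at h
  exact h

/-- ★ **GRADIENT ENERGY ≤ CURL_HS + DIV_HS AT THE FLAT MEMBER** (operator norms on the left, `|X|² ≤ Σ_{jk}|X_{jk}|²` by lit ✓`MatrixNorms.opNorm_sq_le_sum_norm_sq`):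
`Σ_x Σ_κ Σ_ν ‖Y(x+e_ν, κ) − Y(x, κ)‖² ≤ CURL_HS(1, Y) + DIV_HS(1, Y)` — the right side of (QB)'s legs slot at `W = 1`.
[cite: Balaban1984PropagatorsI, (1.21) p.21; Balaban1985Averaging, (20) p.21] -/
theorem sum_grad_sq_le_curlHS_add_divBHS_one (Y : PBond P 0 → Matrix (Fin 2) (Fin 2) ℂ) :
    ∑ x : Site P 0, ∑ κ : Fin P.d, ∑ ν : Fin P.d, ‖Y ⟨x.shift ν, κ⟩ - Y ⟨x, κ⟩‖ ^ 2
      ≤ (∑ x : Site P 0, ∑ μ : Fin P.d, ∑ ν : Fin P.d,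
            (if μ < ν then ∑ j : Fin 2, ∑ k : Fin 2,
              ‖(curl (torusT P 0) (fun κ z => unitsField (toUField (1 : GaugeField P 0 (Matrix.specialUnitaryGroup (Fin 2) ℂ))) ⟨z, κ⟩)
                  (fun κ z => Y ⟨z, κ⟩) μ ν x) j k‖ ^ 2 else 0))
        + (∑ x : Site P 0, ∑ j : Fin 2, ∑ k : Fin 2,
            ‖(divB (torusT P 0) (fun κ z => unitsField (toUField (1 : GaugeField P 0 (Matrix.specialUnitaryGroup (Fin 2) ℂ))) ⟨z, κ⟩)
                (fun κ z => Y ⟨z, κ⟩) x) j k‖ ^ 2) := by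
  refine le_trans ?_ (sum_gradHS_le_curlHS_add_divBHS_one Y)
  refine Finset.sum_le_sum fun x _ => Finset.sum_le_sum fun κ _ => Finset.sum_le_sum fun ν _ => ?_
  exact MatrixNorms.opNorm_sq_le_sum_norm_sq _

end Flat

/-! ## §2 ★★★ (QB) at the flat member, every direction -/

section Member

/-- ★★★ **(QB) AT THE FLAT MEMBER, EVERY DIRECTION, UNCONDITIONAL.**  Per `L > 1` an L-only `Cq ≥ 0` (`= 2·Cr(L)` of ✓`rlegs_flat`) such that for every member `F` with
`F.L = L`, `n < K`, every family `Q₁` satisfying (QB)'s displayed recursion AT `W := 1` (then `Q₁ = ` the `linAvg` tower, ✓`trueLinStep_one_eq_linAvg`) and EVERY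
`A : PBond (F.P K) 0 → M₂(ℂ)`:
`Σ_{ĉ : PBond (F.P K) (K−n)} ‖Q₁ (K−n) A ĉ‖² ≤ 2·Σ_{c : PBond (F.P n) 0} ‖frobEquiv⁻¹(QTw 1 A c)‖² + Cq·L^{K−n}·(CURL_HS(1, A) + DIV_HS(1, A))`.
Proof: reindex `ĉ ↔ c` (lit `bondShift` is an `Equiv`), px21 ✓`QTw_one_apply` per bond, `‖a+b‖² ≤ 2‖a‖²+2‖b‖²`, `|·| ≤ ‖·‖_F`, px19 g6 ✓`rlegs_flat`, §1.
[cite: Balaban1985BackgroundPropagators, (3.13)-(3.15) p.393; Balaban1985Averaging, (89) p.31, (124)-(127) pp.36-37, (160) p.42; Balaban1984PropagatorsI, (1.18)-(1.21) pp.19-21] -/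
theorem trueAvgBudget_flat : ∀ (L : ℕ), 1 < L → ∃ Cq : ℝ, 0 ≤ Cq ∧
    ∀ (F : T3Family), F.L = L → ∀ (n K : ℕ) (hnK : n < K)
      (Q₁ : (k : ℕ) → (PBond (F.P K) 0 → Matrix (Fin 2) (Fin 2) ℂ) → PBond (F.P K) k → Matrix (Fin 2) (Fin 2) ℂ),
      (∀ Y, Q₁ 0 Y = Y) →
      (∀ (k : ℕ) (Y : PBond (F.P K) 0 → Matrix (Fin 2) (Fin 2) ℂ) (c : PBond (F.P K) (k + 1)), Q₁ (k + 1) Y c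
        = (fderiv ℂ (eml : (Idx (F.P K) → Matrix (Fin 2) (Fin 2) ℂ) → Matrix (Fin 2) (Fin 2) ℂ)
              (fun i => ((loopHol (Averaging.iter (fun i => blockAvg (P := (F.P K)) (j := i) (expMeanLogSU (n := Fin 2))) k
                (1 : GaugeField (F.P K) 0 (Matrix.specialUnitaryGroup (Fin 2) ℂ))) c i : Matrix.specialUnitaryGroup (Fin 2) ℂ) : Matrix (Fin 2) (Fin 2) ℂ))
              (fun i => covWalkSum (Averaging.iter (fun i => blockAvg (P := (F.P K)) (j := i) (expMeanLogSU (n := Fin 2))) k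
                  (1 : GaugeField (F.P K) 0 (Matrix.specialUnitaryGroup (Fin 2) ℂ))) (Q₁ k Y) (walk (emb c.src) (loopWord (F.P K).L c.dir (off i.1) i.2.1 i.2.2))
                * ((loopHol (Averaging.iter (fun i => blockAvg (P := (F.P K)) (j := i) (expMeanLogSU (n := Fin 2))) k
                  (1 : GaugeField (F.P K) 0 (Matrix.specialUnitaryGroup (Fin 2) ℂ))) c i : Matrix.specialUnitaryGroup (Fin 2) ℂ) : Matrix (Fin 2) (Fin 2) ℂ))
              * star ((corr (expMeanLogSU (n := Fin 2)) (Averaging.iter (fun i => blockAvg (P := (F.P K)) (j := i) (expMeanLogSU (n := Fin 2))) k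
                  (1 : GaugeField (F.P K) 0 (Matrix.specialUnitaryGroup (Fin 2) ℂ))) c : Matrix.specialUnitaryGroup (Fin 2) ℂ) : Matrix (Fin 2) (Fin 2) ℂ)
            + ((corr (expMeanLogSU (n := Fin 2)) (Averaging.iter (fun i => blockAvg (P := (F.P K)) (j := i) (expMeanLogSU (n := Fin 2))) k
                  (1 : GaugeField (F.P K) 0 (Matrix.specialUnitaryGroup (Fin 2) ℂ))) c : Matrix.specialUnitaryGroup (Fin 2) ℂ) : Matrix (Fin 2) (Fin 2) ℂ)
              * covWalkSum (Averaging.iter (fun i => blockAvg (P := (F.P K)) (j := i) (expMeanLogSU (n := Fin 2))) k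
                  (1 : GaugeField (F.P K) 0 (Matrix.specialUnitaryGroup (Fin 2) ℂ))) (Q₁ k Y) (walk (emb c.src) (List.replicate (F.P K).L (c.dir, true)))
              * star ((corr (expMeanLogSU (n := Fin 2)) (Averaging.iter (fun i => blockAvg (P := (F.P K)) (j := i) (expMeanLogSU (n := Fin 2))) k
                  (1 : GaugeField (F.P K) 0 (Matrix.specialUnitaryGroup (Fin 2) ℂ))) c : Matrix.specialUnitaryGroup (Fin 2) ℂ) : Matrix (Fin 2) (Fin 2) ℂ))) →
      ∀ (A : PBond (F.P K) 0 → Matrix (Fin 2) (Fin 2) ℂ),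
        ∑ c' : PBond (F.P K) (K - n), ‖Q₁ (K - n) A c'‖ ^ 2
          ≤ 2 * (∑ c' : PBond (F.P n) 0, ‖(frobEquiv.symm (QTw F n K hnK.le (1 : GaugeField (F.P K) 0 (Matrix.specialUnitaryGroup (Fin 2) ℂ)) A c') : W₂)‖ ^ 2)
            + Cq * (F.L : ℝ) ^ (K - n) * ((∑ x : Site (F.P K) 0, ∑ μ : Fin (F.P K).d, ∑ ν : Fin (F.P K).d,
                  (if μ < ν then ∑ j : Fin 2, ∑ k : Fin 2,
                    ‖(curl (torusT (F.P K) 0) (fun κ z => unitsField (toUField (1 : GaugeField (F.P K) 0 (Matrix.specialUnitaryGroup (Fin 2) ℂ))) ⟨z, κ⟩)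
                        (fun κ z => A ⟨z, κ⟩) μ ν x) j k‖ ^ 2 else 0))
                + (∑ x : Site (F.P K) 0, ∑ j : Fin 2, ∑ k : Fin 2,
                  ‖(divB (torusT (F.P K) 0) (fun κ z => unitsField (toUField (1 : GaugeField (F.P K) 0 (Matrix.specialUnitaryGroup (Fin 2) ℂ))) ⟨z, κ⟩)
                      (fun κ z => A ⟨z, κ⟩) x) j k‖ ^ 2)) := by
  intro L hL
  obtain ⟨Cr, hCr, hlegs⟩ := rlegs_flat L hL
  refine ⟨2 * Cr, by positivity, ?_⟩
  intro F hF n K hnK Q₁ hQ0₁ hQs₁ A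
  -- (1) at the flat member the true linearised step is `linAvg`
  have hQs₁' : ∀ (i : ℕ) (Y : PBond (F.P K) 0 → Matrix (Fin 2) (Fin 2) ℂ) (c : PBond (F.P K) (i + 1)),
      Q₁ (i + 1) Y c = linAvg (Q₁ i Y) c := fun i Y c =>
    (hQs₁ i Y c).trans (trueLinStep_one_eq_linAvg i (Q₁ i Y) c)
  -- the legs letters (px19 g6 `rlegs_flat`)
  set Rs : PBond (F.P n) 0 → Matrix (Fin 2) (Fin 2) ℂ := fun c =>
    ∑ j ∈ Finset.range (K - n), Fhat (F.P K).L (linQIter (F.P K).L (fun (z : Zd 3) (κ : Fin 3) => A ⟨transl (basePt F n K) z, κ⟩) j)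
      ((((F.P K).L : ℤ) ^ (K - n - j)) • (fun i : Fin 3 => coordT3 F n K hnK.le c.src i)) with hRs
  set Rt : PBond (F.P n) 0 → Matrix (Fin 2) (Fin 2) ℂ := fun c =>
    ∑ j ∈ Finset.range (K - n), Fhat (F.P K).L (linQIter (F.P K).L (fun (z : Zd 3) (κ : Fin 3) => A ⟨transl (basePt F n K) z, κ⟩) j)
      ((((F.P K).L : ℤ) ^ (K - n - j)) • (fun i : Fin 3 => coordT3 F n K hnK.le c.tgt i)) with hRt
  have hR : ∑ c : PBond (F.P n) 0, ‖Rs c - Rt c‖ ^ 2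
      ≤ Cr * (F.L : ℝ) ^ (K - n) * ∑ x : Site (F.P K) 0, ∑ κ : Fin 3, ∑ ν : Fin 3, ‖A ⟨x.shift ν, κ⟩ - A ⟨x, κ⟩‖ ^ 2 :=
    hlegs F hF n K hnK A
  -- (2) px21's explicit formula, per bond: `Q₁^{(K−n)}A ĉ = QTw 1 A c + (Rs c − Rt c)`
  have hper : ∀ c : PBond (F.P n) 0,
      Q₁ (K - n) A (bondShift (sites_eq F n K hnK.le) c)
        = QTw F n K hnK.le (1 : GaugeField (F.P K) 0 (Matrix.specialUnitaryGroup (Fin 2) ℂ)) A c + (Rs c - Rt c) := by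
    intro c
    have h := QTw_one_apply F hnK.le Q₁ hQ0₁ hQs₁' A c
    rw [h]
    exact (sub_add_cancel _ _).symm
  -- abbreviations
  set ℓ : ℝ := (F.L : ℝ) ^ (K - n) with hℓ
  set CURL := (∑ x : Site (F.P K) 0, ∑ μ : Fin (F.P K).d, ∑ ν : Fin (F.P K).d,
      (if μ < ν then ∑ j : Fin 2, ∑ k : Fin 2,
        ‖(curl (torusT (F.P K) 0) (fun κ z => unitsField (toUField (1 : GaugeField (F.P K) 0 (Matrix.specialUnitaryGroup (Fin 2) ℂ))) ⟨z, κ⟩)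
            (fun κ z => A ⟨z, κ⟩) μ ν x) j k‖ ^ 2 else 0)) with hCURL
  set DIV := (∑ x : Site (F.P K) 0, ∑ j : Fin 2, ∑ k : Fin 2,
      ‖(divB (torusT (F.P K) 0) (fun κ z => unitsField (toUField (1 : GaugeField (F.P K) 0 (Matrix.specialUnitaryGroup (Fin 2) ℂ))) ⟨z, κ⟩)
          (fun κ z => A ⟨z, κ⟩) x) j k‖ ^ 2) with hDIV
  set FQ := (∑ c' : PBond (F.P n) 0,
      ‖(frobEquiv.symm (QTw F n K hnK.le (1 : GaugeField (F.P K) 0 (Matrix.specialUnitaryGroup (Fin 2) ℂ)) A c') : W₂)‖ ^ 2) with hFQ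
  set GRAD := (∑ x : Site (F.P K) 0, ∑ κ : Fin 3, ∑ ν : Fin 3, ‖A ⟨x.shift ν, κ⟩ - A ⟨x, κ⟩‖ ^ 2) with hGRAD
  -- (4) the flat Weitzenböck inequality
  have hW : GRAD ≤ CURL + DIV := sum_grad_sq_le_curlHS_add_divBHS_one (P := F.P K) A
  have hℓ0 : 0 ≤ ℓ := by positivity
  -- reindex `ĉ ↔ c` (lit `bondShift` is an `Equiv`)
  have hre : (∑ c' : PBond (F.P K) (K - n), ‖Q₁ (K - n) A c'‖ ^ 2)
      = ∑ c : PBond (F.P n) 0, ‖Q₁ (K - n) A (bondShift (sites_eq F n K hnK.le) c)‖ ^ 2 :=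
    (Equiv.sum_comp (bondShift (sites_eq F n K hnK.le)) (fun c' => ‖Q₁ (K - n) A c'‖ ^ 2)).symm
  rw [hre]
  -- the chain
  calc ∑ c : PBond (F.P n) 0, ‖Q₁ (K - n) A (bondShift (sites_eq F n K hnK.le) c)‖ ^ 2
      = ∑ c : PBond (F.P n) 0,
          ‖QTw F n K hnK.le (1 : GaugeField (F.P K) 0 (Matrix.specialUnitaryGroup (Fin 2) ℂ)) A c + (Rs c - Rt c)‖ ^ 2 :=
        Finset.sum_congr rfl fun c _ => by rw [hper c]
    _ ≤ ∑ c : PBond (F.P n) 0,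
          (2 * ‖QTw F n K hnK.le (1 : GaugeField (F.P K) 0 (Matrix.specialUnitaryGroup (Fin 2) ℂ)) A c‖ ^ 2 + 2 * ‖Rs c - Rt c‖ ^ 2) :=
        Finset.sum_le_sum fun c _ => by
          -- `‖a + b‖² ≤ 2‖a‖² + 2‖b‖²` (tree: ✓`Prop7PlaqKSlowFastKnit.norm_add_sq_le`, inlined to spare the import)
          nlinarith [norm_add_le (QTw F n K hnK.le (1 : GaugeField (F.P K) 0 (Matrix.specialUnitaryGroup (Fin 2) ℂ)) A c) (Rs c - Rt c),
            norm_nonneg (QTw F n K hnK.le (1 : GaugeField (F.P K) 0 (Matrix.specialUnitaryGroup (Fin 2) ℂ)) A c), norm_nonneg (Rs c - Rt c),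
            norm_nonneg (QTw F n K hnK.le (1 : GaugeField (F.P K) 0 (Matrix.specialUnitaryGroup (Fin 2) ℂ)) A c + (Rs c - Rt c)),
            sq_nonneg (‖QTw F n K hnK.le (1 : GaugeField (F.P K) 0 (Matrix.specialUnitaryGroup (Fin 2) ℂ)) A c‖ - ‖Rs c - Rt c‖)]
    _ = 2 * (∑ c : PBond (F.P n) 0, ‖QTw F n K hnK.le (1 : GaugeField (F.P K) 0 (Matrix.specialUnitaryGroup (Fin 2) ℂ)) A c‖ ^ 2)
          + 2 * (∑ c : PBond (F.P n) 0, ‖Rs c - Rt c‖ ^ 2) := by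
        rw [Finset.sum_add_distrib, Finset.mul_sum, Finset.mul_sum]
    _ ≤ 2 * FQ + 2 * (Cr * ℓ * GRAD) := by
        have hF : (∑ c : PBond (F.P n) 0,
            ‖QTw F n K hnK.le (1 : GaugeField (F.P K) 0 (Matrix.specialUnitaryGroup (Fin 2) ℂ)) A c‖ ^ 2) ≤ FQ := by
          rw [hFQ]
          exact Finset.sum_le_sum fun c _ => pow_le_pow_left₀ (norm_nonneg _) (norm_le_norm_frobEquiv_symm _) 2
        linarith [hF, hR]
    _ ≤ 2 * FQ + 2 * (Cr * ℓ * (CURL + DIV)) := by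
        gcongr
    _ = 2 * FQ + 2 * Cr * (F.L : ℝ) ^ (K - n) * (CURL + DIV) := by rw [hℓ]; ring

end Member

/-! ## §3 The row in `hQB`'s exact shape, and the central specialisation (= px10 (8)'s `hflat`) -/

section Shapes

/-- ★★ **(QB) AT `W := 1`, `hQB`'s RIGHT SIDE TOKEN FOR TOKEN**: the row of §2 with the mass slot `Cq′·e·ℓ⁻¹·Σ_b‖A b‖²` added back (any `Cq′ e` with `0 ≤ Cq′·e`; at the
flat member it is a non-negative add-on, the curved row needs it). [cite: Balaban1985BackgroundPropagators, (3.13)-(3.15) p.393; Balaban1985Variational, (14) p.280, (44) p.285] -/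
theorem trueAvgBudget_flat_row : ∀ (L : ℕ), 1 < L → ∃ Cq : ℝ, 0 ≤ Cq ∧
    ∀ (F : T3Family), F.L = L → ∀ (n K : ℕ) (hnK : n < K)
      (Q₁ : (k : ℕ) → (PBond (F.P K) 0 → Matrix (Fin 2) (Fin 2) ℂ) → PBond (F.P K) k → Matrix (Fin 2) (Fin 2) ℂ),
      (∀ Y, Q₁ 0 Y = Y) →
      (∀ (k : ℕ) (Y : PBond (F.P K) 0 → Matrix (Fin 2) (Fin 2) ℂ) (c : PBond (F.P K) (k + 1)), Q₁ (k + 1) Y c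
        = (fderiv ℂ (eml : (Idx (F.P K) → Matrix (Fin 2) (Fin 2) ℂ) → Matrix (Fin 2) (Fin 2) ℂ)
              (fun i => ((loopHol (Averaging.iter (fun i => blockAvg (P := (F.P K)) (j := i) (expMeanLogSU (n := Fin 2))) k
                (1 : GaugeField (F.P K) 0 (Matrix.specialUnitaryGroup (Fin 2) ℂ))) c i : Matrix.specialUnitaryGroup (Fin 2) ℂ) : Matrix (Fin 2) (Fin 2) ℂ))
              (fun i => covWalkSum (Averaging.iter (fun i => blockAvg (P := (F.P K)) (j := i) (expMeanLogSU (n := Fin 2))) k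
                  (1 : GaugeField (F.P K) 0 (Matrix.specialUnitaryGroup (Fin 2) ℂ))) (Q₁ k Y) (walk (emb c.src) (loopWord (F.P K).L c.dir (off i.1) i.2.1 i.2.2))
                * ((loopHol (Averaging.iter (fun i => blockAvg (P := (F.P K)) (j := i) (expMeanLogSU (n := Fin 2))) k
                  (1 : GaugeField (F.P K) 0 (Matrix.specialUnitaryGroup (Fin 2) ℂ))) c i : Matrix.specialUnitaryGroup (Fin 2) ℂ) : Matrix (Fin 2) (Fin 2) ℂ))
              * star ((corr (expMeanLogSU (n := Fin 2)) (Averaging.iter (fun i => blockAvg (P := (F.P K)) (j := i) (expMeanLogSU (n := Fin 2))) k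
                  (1 : GaugeField (F.P K) 0 (Matrix.specialUnitaryGroup (Fin 2) ℂ))) c : Matrix.specialUnitaryGroup (Fin 2) ℂ) : Matrix (Fin 2) (Fin 2) ℂ)
            + ((corr (expMeanLogSU (n := Fin 2)) (Averaging.iter (fun i => blockAvg (P := (F.P K)) (j := i) (expMeanLogSU (n := Fin 2))) k
                  (1 : GaugeField (F.P K) 0 (Matrix.specialUnitaryGroup (Fin 2) ℂ))) c : Matrix.specialUnitaryGroup (Fin 2) ℂ) : Matrix (Fin 2) (Fin 2) ℂ)
              * covWalkSum (Averaging.iter (fun i => blockAvg (P := (F.P K)) (j := i) (expMeanLogSU (n := Fin 2))) k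
                  (1 : GaugeField (F.P K) 0 (Matrix.specialUnitaryGroup (Fin 2) ℂ))) (Q₁ k Y) (walk (emb c.src) (List.replicate (F.P K).L (c.dir, true)))
              * star ((corr (expMeanLogSU (n := Fin 2)) (Averaging.iter (fun i => blockAvg (P := (F.P K)) (j := i) (expMeanLogSU (n := Fin 2))) k
                  (1 : GaugeField (F.P K) 0 (Matrix.specialUnitaryGroup (Fin 2) ℂ))) c : Matrix.specialUnitaryGroup (Fin 2) ℂ) : Matrix (Fin 2) (Fin 2) ℂ))) →
      ∀ (Cq' e : ℝ), 0 ≤ Cq' * e → ∀ (A : PBond (F.P K) 0 → Matrix (Fin 2) (Fin 2) ℂ),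
        ∑ c' : PBond (F.P K) (K - n), ‖Q₁ (K - n) A c'‖ ^ 2
          ≤ 2 * (∑ c' : PBond (F.P n) 0, ‖(frobEquiv.symm (QTw F n K hnK.le (1 : GaugeField (F.P K) 0 (Matrix.specialUnitaryGroup (Fin 2) ℂ)) A c') : W₂)‖ ^ 2)
            + Cq * (F.L : ℝ) ^ (K - n) * ((∑ x : Site (F.P K) 0, ∑ μ : Fin (F.P K).d, ∑ ν : Fin (F.P K).d,
                  (if μ < ν then ∑ j : Fin 2, ∑ k : Fin 2,
                    ‖(curl (torusT (F.P K) 0) (fun κ z => unitsField (toUField (1 : GaugeField (F.P K) 0 (Matrix.specialUnitaryGroup (Fin 2) ℂ))) ⟨z, κ⟩)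
                        (fun κ z => A ⟨z, κ⟩) μ ν x) j k‖ ^ 2 else 0))
                + (∑ x : Site (F.P K) 0, ∑ j : Fin 2, ∑ k : Fin 2,
                  ‖(divB (torusT (F.P K) 0) (fun κ z => unitsField (toUField (1 : GaugeField (F.P K) 0 (Matrix.specialUnitaryGroup (Fin 2) ℂ))) ⟨z, κ⟩)
                      (fun κ z => A ⟨z, κ⟩) x) j k‖ ^ 2))
            + Cq' * e * ((F.L : ℝ) ^ (K - n))⁻¹ * (∑ b : PBond (F.P K) 0, ‖A b‖ ^ 2) := by
  intro L hL
  obtain ⟨Cq, hCq, hrow⟩ := trueAvgBudget_flat L hL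
  refine ⟨Cq, hCq, ?_⟩
  intro F hF n K hnK Q₁ hQ0₁ hQs₁ Cq' e hCe A
  have h := hrow F hF n K hnK Q₁ hQ0₁ hQs₁ A
  have hadd : 0 ≤ Cq' * e * ((F.L : ℝ) ^ (K - n))⁻¹ * (∑ b : PBond (F.P K) 0, ‖A b‖ ^ 2) :=
    mul_nonneg (mul_nonneg hCe (by positivity)) (Finset.sum_nonneg fun _ _ => sq_nonneg _)
  linarith

/-- ★★ **(QB) AT `W := 1` ON CENTRAL FIELDS `A = c·1` — px10 (8)'s `hflat` TOKEN FOR TOKEN** (the instance `A := fun b ↦ c b • 1` of `trueAvgBudget_flat_row`, written β-reduced as in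
✓`Prop7TrueAvgBudgetCentral.trueAvgBudget_smul_one_of_flat`).  With px10's ✓`Prop7TrueLinCentralRegPr` ∕ `Prop7TrueAvgBudgetCentral` the central sector of (QB) at `W ∈ RegPr` follows
by name. [cite: Balaban1985BackgroundPropagators, (3.4) p.391, (3.8) p.392, (3.13)-(3.15) p.393; Balaban1984PropagatorsI, (1.18)-(1.21) pp.19-21] -/
theorem trueAvgBudget_smul_one_flat : ∀ (L : ℕ), 1 < L → ∃ Cq : ℝ, 0 ≤ Cq ∧
    ∀ (F : T3Family), F.L = L → ∀ (n K : ℕ) (hnK : n < K)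
      (Q₁ : (k : ℕ) → (PBond (F.P K) 0 → Matrix (Fin 2) (Fin 2) ℂ) → PBond (F.P K) k → Matrix (Fin 2) (Fin 2) ℂ),
      (∀ Y, Q₁ 0 Y = Y) →
      (∀ (k : ℕ) (Y : PBond (F.P K) 0 → Matrix (Fin 2) (Fin 2) ℂ) (c : PBond (F.P K) (k + 1)), Q₁ (k + 1) Y c
        = (fderiv ℂ (eml : (Idx (F.P K) → Matrix (Fin 2) (Fin 2) ℂ) → Matrix (Fin 2) (Fin 2) ℂ)
              (fun i => ((loopHol (Averaging.iter (fun i => blockAvg (P := (F.P K)) (j := i) (expMeanLogSU (n := Fin 2))) k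
                (1 : GaugeField (F.P K) 0 (Matrix.specialUnitaryGroup (Fin 2) ℂ))) c i : Matrix.specialUnitaryGroup (Fin 2) ℂ) : Matrix (Fin 2) (Fin 2) ℂ))
              (fun i => covWalkSum (Averaging.iter (fun i => blockAvg (P := (F.P K)) (j := i) (expMeanLogSU (n := Fin 2))) k
                  (1 : GaugeField (F.P K) 0 (Matrix.specialUnitaryGroup (Fin 2) ℂ))) (Q₁ k Y) (walk (emb c.src) (loopWord (F.P K).L c.dir (off i.1) i.2.1 i.2.2))
                * ((loopHol (Averaging.iter (fun i => blockAvg (P := (F.P K)) (j := i) (expMeanLogSU (n := Fin 2))) k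
                  (1 : GaugeField (F.P K) 0 (Matrix.specialUnitaryGroup (Fin 2) ℂ))) c i : Matrix.specialUnitaryGroup (Fin 2) ℂ) : Matrix (Fin 2) (Fin 2) ℂ))
              * star ((corr (expMeanLogSU (n := Fin 2)) (Averaging.iter (fun i => blockAvg (P := (F.P K)) (j := i) (expMeanLogSU (n := Fin 2))) k
                  (1 : GaugeField (F.P K) 0 (Matrix.specialUnitaryGroup (Fin 2) ℂ))) c : Matrix.specialUnitaryGroup (Fin 2) ℂ) : Matrix (Fin 2) (Fin 2) ℂ)
            + ((corr (expMeanLogSU (n := Fin 2)) (Averaging.iter (fun i => blockAvg (P := (F.P K)) (j := i) (expMeanLogSU (n := Fin 2))) k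
                  (1 : GaugeField (F.P K) 0 (Matrix.specialUnitaryGroup (Fin 2) ℂ))) c : Matrix.specialUnitaryGroup (Fin 2) ℂ) : Matrix (Fin 2) (Fin 2) ℂ)
              * covWalkSum (Averaging.iter (fun i => blockAvg (P := (F.P K)) (j := i) (expMeanLogSU (n := Fin 2))) k
                  (1 : GaugeField (F.P K) 0 (Matrix.specialUnitaryGroup (Fin 2) ℂ))) (Q₁ k Y) (walk (emb c.src) (List.replicate (F.P K).L (c.dir, true)))
              * star ((corr (expMeanLogSU (n := Fin 2)) (Averaging.iter (fun i => blockAvg (P := (F.P K)) (j := i) (expMeanLogSU (n := Fin 2))) k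
                  (1 : GaugeField (F.P K) 0 (Matrix.specialUnitaryGroup (Fin 2) ℂ))) c : Matrix.specialUnitaryGroup (Fin 2) ℂ) : Matrix (Fin 2) (Fin 2) ℂ))) →
      ∀ (Cq' e : ℝ), 0 ≤ Cq' * e → ∀ (c : PBond (F.P K) 0 → ℂ),
        ∑ c' : PBond (F.P K) (K - n), ‖Q₁ (K - n) (fun b => c b • (1 : Matrix (Fin 2) (Fin 2) ℂ)) c'‖ ^ 2
          ≤ 2 * (∑ c' : PBond (F.P n) 0, ‖(frobEquiv.symm (QTw F n K hnK.le (1 : GaugeField (F.P K) 0 (Matrix.specialUnitaryGroup (Fin 2) ℂ))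
                (fun b => c b • (1 : Matrix (Fin 2) (Fin 2) ℂ)) c') : W₂)‖ ^ 2)
            + Cq * (F.L : ℝ) ^ (K - n) * ((∑ x : Site (F.P K) 0, ∑ μ : Fin (F.P K).d, ∑ ν : Fin (F.P K).d,
                  (if μ < ν then ∑ j : Fin 2, ∑ k : Fin 2,
                    ‖(curl (torusT (F.P K) 0) (fun κ z => unitsField (toUField (1 : GaugeField (F.P K) 0 (Matrix.specialUnitaryGroup (Fin 2) ℂ))) ⟨z, κ⟩)
                        (fun κ z => c ⟨z, κ⟩ • (1 : Matrix (Fin 2) (Fin 2) ℂ)) μ ν x) j k‖ ^ 2 else 0))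
                + (∑ x : Site (F.P K) 0, ∑ j : Fin 2, ∑ k : Fin 2,
                  ‖(divB (torusT (F.P K) 0) (fun κ z => unitsField (toUField (1 : GaugeField (F.P K) 0 (Matrix.specialUnitaryGroup (Fin 2) ℂ))) ⟨z, κ⟩)
                      (fun κ z => c ⟨z, κ⟩ • (1 : Matrix (Fin 2) (Fin 2) ℂ)) x) j k‖ ^ 2))
            + Cq' * e * ((F.L : ℝ) ^ (K - n))⁻¹ * (∑ b : PBond (F.P K) 0, ‖c b • (1 : Matrix (Fin 2) (Fin 2) ℂ)‖ ^ 2) := by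
  intro L hL
  obtain ⟨Cq, hCq, hrow⟩ := trueAvgBudget_flat_row L hL
  refine ⟨Cq, hCq, ?_⟩
  intro F hF n K hnK Q₁ hQ0₁ hQs₁ Cq' e hCe c
  exact hrow F hF n K hnK Q₁ hQ0₁ hQs₁ Cq' e hCe (fun b => c b • (1 : Matrix (Fin 2) (Fin 2) ℂ))

end Shapes

end Summit.QuantumFields.YangMills.Theorems.Prop7TrueAvgBudgetFlat

end
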